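import Summits.HodgeConjecture.CorCM.MumfordTateRankTypeIVTimesCMCurvesTower
import Summits.HodgeConjecture.CorCM.MumfordTateRankTypeIVTimesCMCurveRigid
import Literature.AlgebraicGeometry.Motives.HodgeLieTimesCMSummandRigid
import HarnessLib

/-!
# The tower `A × E₀ × ⋯ × E_m` is `Θ`-RIGID for a `Θ`-rigid `A` with imaginary-quadratic `End⁰A`; `t((A × ⨁E) × Y) ≥ t(A) + m + 1`;
# the same-field stacking cells `T_IV × E_k × E₀ × ⋯ × E_m = m + 11`, Ribet `(g−1,1) × E_k × ⨁E = g² + m + 2` (Moonen–Zarhin 1999 §3)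

COR-CM (cell `pub-hodgecm2`, seat `b27` gen 51, count-neutral Mumford–Tate-rank ladder; theorems only, no definition, no named fact;
UNCONDITIONAL — nothing here uses or asserts HC_CM).  Notation `t(X) = dim MT(H¹X) = dim Lie Hg(H¹X) + 1`.

Gen 50 proved that `Θ`-rigidity passes from `A` to `A × E'` along ONE CM elliptic curve of another field (`CorCM/MumfordTateRankTypeIVTimesCMCurveRigid`,
the rank-one trace test).  Here the whole tower is treated at once: `Motives/HodgeLieTimesCMSummandRigid` (rigidity is inherited along an ABELIAN
twisted-rigid summand of any rank) on the bicone `H¹(A × Y) = fst^* H¹A ⊕ snd^* H¹Y`, `Y = ⨁_j E_j`, fed with the twisted rigidity of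
`Lie Hg(H¹Y)` (`CorCM/MumfordTateRankCMCurvesProductTheta`: trace functionals + Besicovitch).

* §1 **`hodgeLie_rigid_prod_biproduct_cmCurves_of_rigid_of_quadraticEnd`** — `H¹(A × ⨁E)` is `Θ`-rigid for `A` with `0 < dim A`, `dim_ℚ End⁰A = 2`,
  `φ ∘ φ = −d`, `Θ`-rigid `H¹A`, and elliptic curves with `χ_j ∘ χ_j = −d_j`, `d_i ≠ s²d_j` (`i ≠ j`), and (`A` balanced OR `d ≠ s²d_j` for all `j`).
* §2 field forms: **`hodgeLie_rigid_prod_biproduct_cmCurves_of_rigid`** (pairwise non-isogenous CM curves; `A` balanced OR `End⁰E_j ↛ End⁰A`);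
  simple threefolds with `dim_ℚ End⁰T = 2` and Ribet type `(g − 1, 1)`.
* §3 monotonicity **`mtRank_hodge_one_add_le_of_isIsogenous_prod_biproduct_cmCurves_prod_of_rigid`**: `t(A) + m + 1 ≤ t(X)` for EVERY
  `X ∼ (A × ⨁E) × Y`; `m + 11 ≤ t(X)` (type IV(2,1)), `g² + m + 2 ≤ t(X)` (Ribet).
* §4 the SAME-FIELD STACKING cells: **`mtRank_hodge_one_eq_of_isIsogenous_threefold_prod_biproduct_cmCurves_prod_sameField`** — `T` a simple
  threefold with `End⁰T = k` imaginary quadratic, `E₀, …, E_m` pairwise non-isogenous CM curves with `End⁰E_j ↛ k`, `E` a CM curve with `End⁰E ↪ k`: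
  **`t(T × E₀ × ⋯ × E_m × E) = m + 11`** (`= t(T × ⨁E)`: the curve of the field `k` is ABSORBED, `Hg = U(2,1) × U(1)^{m+1}`), by the sandwich
  `t(T × ⨁E) ≤ t(X) ≤ t(E × T) + (m + 1) = 10 + m + 1`; the Ribet analogue **`= g² + m + 2`**.

## References
* [MoonenZarhin1999LowDim] B. Moonen, Yu. G. Zarhin, *Hodge classes on abelian varieties of low dimension*, Math. Ann. 315 (1999), §3 (3.1),
  Lemma (3.6), Prop. (3.8), Thm. 0.1 (4) [corpus: paper:arxiv-math_9901113 pp. 1, 6–7]. [cite: MoonenZarhin1999LowDim, §3 (3.1), (3.6) and (3.8)]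
* [Besicovitch1940] A. S. Besicovitch, *On the linear independence of fractional powers of integers*, J. London Math. Soc. 15 (1940) 3–6. [cite: Besicovitch1940, Thm. 1]
* [Deligne1982HodgeCycles] P. Deligne, LNM 900 (1982), I §3.1, Prop. 3.4 and Prop. 3.6. [cite: Deligne1982HodgeCycles, I §3 Prop. 3.6]
* [Ribet1983] K. A. Ribet, Amer. J. Math. 105 (1983), Thm. 3. [cite: Ribet1983, Thm. 3]
-/

noncomputable section

open scoped TensorProduct BigOperators
open CategoryTheory CategoryTheory.Limits Module

namespace Summit.HodgeConjecture.CorCM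

open Literature.AlgebraicGeometry.Motives
open Literature.AlgebraicGeometry.Motives.AbelianVariety
open Literature.AlgebraicGeometry.Motives.HodgeStructure
open Literature.AlgebraicGeometry.HodgeTheory
open Literature.AlgebraicGeometry.ComplexMultiplication
open Literature.AlgebraicGeometry.Milne1999 (IsOfCMType)

variable [HodgeTensorFacts.{0, 0}] {X A : AbelianVariety ℂ} {n n₁ l : ℕ} {m : ℕ} {E : Fin (m + 1) → AbelianVariety ℂ}

/-! ## §1 The tower is `Θ`-rigid -/

/-- **`H¹(A × ⨁_j E_j)` is `Θ`-rigid** for `A` with `0 < dim A`, `dim_ℚ End⁰A = 2`, `φ ∘ φ = −d` (`d > 0`) and `Θ`-RIGID `H¹A`, elliptic curves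
`E₀, …, E_m` with `χ_j ∘ χ_j = −d_j`, `d_i ≠ s²d_j` for `i ≠ j`, provided `A` is balanced (`n₊ = n₋`) OR `d ≠ s²d_j` for all `j`.
`Motives/HodgeLieTimesCMSummandRigid` on the bicone `H¹(A × Y) = fst^* H¹A ⊕ snd^* H¹Y`: skew centre `ℚφ^*` on `H¹A` (`quadraticEnd_skewCentre_data`),
`Lie Hg(H¹Y)` abelian and twisted-rigid for the slope `tr(Θ_A φ^*)/tr((φ^*)²)`, `tr(Θ_A φ^*) = 2i√d(n₊ − n₋)` (`CorCM/MumfordTateRankCMCurvesProductTheta`).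
[cite: MoonenZarhin1999LowDim, §3 (3.1), (3.6) and (3.8)] [cite: Deligne1982HodgeCycles, I §3 Prop. 3.6] -/
theorem hodgeLie_rigid_prod_biproduct_cmCurves_of_rigid_of_quadraticEnd (hA : IsSmoothProjective n₁ A.X)
    (hP : IsSmoothProjective l (A.prod (⨁ E)).X) (hA0 : 0 < A.dim) (hA2 : Module.finrank ℚ A.endAlgebra = 2)
    (φ : A ⟶ A) {d : ℕ} (hd : 0 < d) (hφ : φ ≫ φ = -(d • 𝟙 A))
    (hrigA : haveI := BettiUniverse.finite hA 1
      ∀ 𝔞 : Submodule ℚ (Module.End ℚ (bettiCohomology A.X 1)),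
        𝔞 ≤ (BettiUniverse.hodge exists_isReal_hodgeModel_holds hA 1).hodgeLie →
        (∀ B ∈ 𝔞, ∀ B' ∈ 𝔞, B * B' - B' * B ∈ 𝔞) →
        (∃ Θ ∈ Submodule.span ℂ ((fun B : Module.End ℚ (bettiCohomology A.X 1) => B.baseChange ℂ) ''
            (𝔞 : Set (Module.End ℚ (bettiCohomology A.X 1)))),
          ∀ p, ∀ x ∈ (BettiUniverse.hodge exists_isReal_hodgeModel_holds hA 1).piece p (((1 : ℕ) : ℤ) - p),
            Θ x = ((2 * p - ((1 : ℕ) : ℤ) : ℤ) : ℂ) • x) →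
        (BettiUniverse.hodge exists_isReal_hodgeModel_holds hA 1).hodgeLie ≤ 𝔞)
    (hE1 : ∀ j, (E j).dim = 1) (χ : ∀ j, E j ⟶ E j) (dE : Fin (m + 1) → ℕ) (hdE : ∀ j, 0 < dE j) (hχ : ∀ j, χ j ≫ χ j = -(dE j • 𝟙 (E j)))
    (hfree : ∀ i j, i ≠ j → ∀ s : ℚ, (dE i : ℚ) ≠ s ^ 2 * dE j)
    (hbal : eigenMultiplicity A φ (Complex.I * (Real.sqrt d : ℂ)) = eigenMultiplicity A φ (-(Complex.I * (Real.sqrt d : ℂ))) ∨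
      ∀ j, ∀ s : ℚ, (d : ℚ) ≠ s ^ 2 * dE j) :
    haveI := BettiUniverse.finite hP 1
    ∀ 𝔞 : Submodule ℚ (Module.End ℚ (bettiCohomology (A.prod (⨁ E)).X 1)),
      𝔞 ≤ (BettiUniverse.hodge exists_isReal_hodgeModel_holds hP 1).hodgeLie →
      (∀ B ∈ 𝔞, ∀ B' ∈ 𝔞, B * B' - B' * B ∈ 𝔞) →
      (∃ Θ ∈ Submodule.span ℂ ((fun B : Module.End ℚ (bettiCohomology (A.prod (⨁ E)).X 1) => B.baseChange ℂ) ''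
          (𝔞 : Set (Module.End ℚ (bettiCohomology (A.prod (⨁ E)).X 1)))),
        ∀ p, ∀ x ∈ (BettiUniverse.hodge exists_isReal_hodgeModel_holds hP 1).piece p (((1 : ℕ) : ℤ) - p),
          Θ x = ((2 * p - ((1 : ℕ) : ℤ) : ℤ) : ℂ) • x) →
      (BettiUniverse.hodge exists_isReal_hodgeModel_holds hP 1).hodgeLie ≤ 𝔞 := by
  classical
  have hnA : A.dim = n₁ := schemeDim_eq_holds hA
  subst hnA
  have hY : IsSmoothProjective (⨁ E).dim (⨁ E).X := AbelianVariety.isSmoothProjective_holds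
  haveI := BettiUniverse.finite hP 1
  haveI := BettiUniverse.finite hA 1
  haveI := BettiUniverse.finite hY 1
  -- the bicone of `H¹`
  let ι₁ := BettiUniverse.pullHodgeHom exists_isReal_hodgeModel_holds hodgePQ_independent_of_hodgeModel_holds hP hA
    (fst A (⨁ E)).hom.hom.hom 1
  let π₁ := BettiUniverse.pullHodgeHom exists_isReal_hodgeModel_holds hodgePQ_independent_of_hodgeModel_holds hA hP
    (prodLift (𝟙 A) (0 : A ⟶ ⨁ E)).hom.hom.hom 1
  let ι₂ := BettiUniverse.pullHodgeHom exists_isReal_hodgeModel_holds hodgePQ_independent_of_hodgeModel_holds hP hY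
    (snd A (⨁ E)).hom.hom.hom 1
  let π₂ := BettiUniverse.pullHodgeHom exists_isReal_hodgeModel_holds hodgePQ_independent_of_hodgeModel_holds hY hP
    (prodLift (0 : ⨁ E ⟶ A) (𝟙 (⨁ E))).hom.hom.hom 1
  have hsumP : fst A (⨁ E) ≫ prodLift (𝟙 A) (0 : A ⟶ ⨁ E) + snd A (⨁ E) ≫ prodLift (0 : ⨁ E ⟶ A) (𝟙 (⨁ E)) = 𝟙 _ := by
    refine prod_hom_ext ?_ ?_
    · rw [Preadditive.add_comp, Category.assoc, Category.assoc, prodLift_fst, prodLift_fst, Category.comp_id,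
        comp_zero, add_zero, Category.id_comp]
    · rw [Preadditive.add_comp, Category.assoc, Category.assoc, prodLift_snd, prodLift_snd, Category.comp_id,
        comp_zero, zero_add, Category.id_comp]
  have hπι₁ : ∀ v, π₁.toLinearMap (ι₁.toLinearMap v) = v := fun v => pull_pull_eq_self_of_comp_eq_id (prodLift_fst _ _) v
  have hπι₂ : ∀ v, π₂.toLinearMap (ι₂.toLinearMap v) = v := fun v => pull_pull_eq_self_of_comp_eq_id (prodLift_snd _ _) v
  have hsum : ∀ v, ι₁.toLinearMap (π₁.toLinearMap v) + ι₂.toLinearMap (π₂.toLinearMap v) = v := fun v =>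
    pull_pull_add_pull_pull_eq_self _ _ _ _ hsumP v
  -- polarization of `H¹A`, Hodge operators
  obtain ⟨ψ₁⟩ := BettiUniverse.hodge_isPolarizable exists_isReal_hodgeModel_holds hA 1
  obtain ⟨Θ₁, hΘ₁⟩ := exists_hodgeTheta (BettiUniverse.hodge exists_isReal_hodgeModel_holds hA 1)
  obtain ⟨Θ₂, hΘ₂⟩ := exists_hodgeTheta (BettiUniverse.hodge exists_isReal_hodgeModel_holds hY 1)
  -- the data on `A`: `φ^*` and the skew centre `ℚφ^*`
  obtain ⟨hφE, -, hZ⟩ := quadraticEnd_skewCentre_data exists_isReal_hodgeModel_holds hodgePQ_independent_of_hodgeModel_holds hA0 hA2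
    hd hφ ψ₁
  -- the data on `Y = ⨁E`: abelian `Lie Hg`
  obtain ⟨hab₂, -⟩ := hodgeLie_hodge_one_biproduct_cmCurves_comm_and_finrank hY hE1 χ dE hdE hχ hfree
  -- the slope
  set T : ℚ := LinearMap.trace ℚ _ ((bettiCohomology.map φ.hom.hom.hom 1).hom * (bettiCohomology.map φ.hom.hom.hom 1).hom) with hTdef
  set Sc : ℂ := LinearMap.trace ℂ _ (Θ₁ * (bettiCohomology.map φ.hom.hom.hom 1).hom.baseChange ℂ) with hScdef
  have hT : T = -((d : ℚ) * (2 * A.dim)) := trace_pullback_mul_self_eq φ hφ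
  have hT0 : T ≠ 0 := by
    rw [hT]
    have hdQ : (d : ℚ) ≠ 0 := by exact_mod_cast hd.ne'
    have hdim : ((A.dim : ℕ) : ℚ) ≠ 0 := by exact_mod_cast hA0.ne'
    exact neg_ne_zero.2 (mul_ne_zero hdQ (mul_ne_zero two_ne_zero hdim))
  set r : ℚ := (eigenMultiplicity A φ (Complex.I * (Real.sqrt d : ℂ)) : ℚ) - (eigenMultiplicity A φ (-(Complex.I * (Real.sqrt d : ℂ))) : ℚ)
    with hrdef
  have hSc : Sc = 2 * (Complex.I * (Real.sqrt d : ℂ)) * (r : ℂ) := by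
    rw [hScdef, trace_theta_mul_baseChange_pullback_eq exists_isReal_hodgeModel_holds hodgePQ_independent_of_hodgeModel_holds φ hd hφ hΘ₁, hrdef]
    push_cast
    ring
  have hr : r = 0 ∨ ∀ j, ∀ s : ℚ, (d : ℚ) ≠ s ^ 2 * dE j := by
    rcases hbal with h | h
    · left
      rw [hrdef, h, sub_self]
    · exact Or.inr h
  -- twisted rigidity of `H¹Y` for this slope
  have hrig : ∀ K : Submodule ℚ (Module.End ℚ (bettiCohomology (⨁ E).X 1)), K ≤ (BettiUniverse.hodge exists_isReal_hodgeModel_holds hY 1).hodgeLie →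
      ∀ y₀ ∈ (BettiUniverse.hodge exists_isReal_hodgeModel_holds hY 1).hodgeLie,
        ((T : ℚ) : ℂ) • Θ₂ - Sc • y₀.baseChange ℂ ∈ spanC K → (BettiUniverse.hodge exists_isReal_hodgeModel_holds hY 1).hodgeLie ≤ K := by
    intro K hK y₀ hy₀ hmem
    rw [hSc] at hmem
    exact hodgeLie_hodge_one_biproduct_cmCurves_le_of_resonance hY hE1 χ dE hdE hχ hfree hΘ₂ hT0 hd hr K hK hy₀ hmem
  exact rigid_of_abelian_of_twistedRigid_of_rigid ι₁ π₁ ι₂ π₂ hπι₁ hπι₂ hsum hrigA ψ₁ hφE hZ hab₂ hΘ₁ hΘ₂ hrig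

/-! ## §2 Field forms -/

/-- **`H¹(A × ⨁_j E_j)` is `Θ`-rigid — field form**: `A` with `0 < dim A`, `dim_ℚ End⁰A = 2`, `φ ∘ φ = −d`, `Θ`-rigid `H¹A`; `E₀, …, E_m` pairwise
non-isogenous CM elliptic curves; and EITHER `A` balanced OR no ring homomorphism `End⁰E_j → End⁰A` for every `j` (distinct CM fields have
non-square ratio of discriminants, `forall_ne_sq_mul_of_isEmpty_ringHom`). [cite: MoonenZarhin1999LowDim, §3 (3.1), (3.6) and (3.8)] -/
theorem hodgeLie_rigid_prod_biproduct_cmCurves_of_rigid (hA : IsSmoothProjective n₁ A.X)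
    (hP : IsSmoothProjective l (A.prod (⨁ E)).X) (hA0 : 0 < A.dim) (hA2 : Module.finrank ℚ A.endAlgebra = 2)
    (φ : A ⟶ A) {d : ℕ} (hd : 0 < d) (hφ : φ ≫ φ = -(d • 𝟙 A))
    (hrigA : haveI := BettiUniverse.finite hA 1
      ∀ 𝔞 : Submodule ℚ (Module.End ℚ (bettiCohomology A.X 1)),
        𝔞 ≤ (BettiUniverse.hodge exists_isReal_hodgeModel_holds hA 1).hodgeLie →
        (∀ B ∈ 𝔞, ∀ B' ∈ 𝔞, B * B' - B' * B ∈ 𝔞) →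
        (∃ Θ ∈ Submodule.span ℂ ((fun B : Module.End ℚ (bettiCohomology A.X 1) => B.baseChange ℂ) ''
            (𝔞 : Set (Module.End ℚ (bettiCohomology A.X 1)))),
          ∀ p, ∀ x ∈ (BettiUniverse.hodge exists_isReal_hodgeModel_holds hA 1).piece p (((1 : ℕ) : ℤ) - p),
            Θ x = ((2 * p - ((1 : ℕ) : ℤ) : ℤ) : ℂ) • x) →
        (BettiUniverse.hodge exists_isReal_hodgeModel_holds hA 1).hodgeLie ≤ 𝔞)
    (hE1 : ∀ j, (E j).dim = 1) (hEcm : ∀ j, IsOfCMType (E j)) (hniso : ∀ i j, i ≠ j → ¬ IsIsogenous (E i) (E j))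
    (hbal : eigenMultiplicity A φ (Complex.I * (Real.sqrt d : ℂ)) = eigenMultiplicity A φ (-(Complex.I * (Real.sqrt d : ℂ))) ∨
      ∀ j, IsEmpty ((E j).endAlgebra →+* A.endAlgebra)) :
    haveI := BettiUniverse.finite hP 1
    ∀ 𝔞 : Submodule ℚ (Module.End ℚ (bettiCohomology (A.prod (⨁ E)).X 1)),
      𝔞 ≤ (BettiUniverse.hodge exists_isReal_hodgeModel_holds hP 1).hodgeLie →
      (∀ B ∈ 𝔞, ∀ B' ∈ 𝔞, B * B' - B' * B ∈ 𝔞) →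
      (∃ Θ ∈ Submodule.span ℂ ((fun B : Module.End ℚ (bettiCohomology (A.prod (⨁ E)).X 1) => B.baseChange ℂ) ''
          (𝔞 : Set (Module.End ℚ (bettiCohomology (A.prod (⨁ E)).X 1)))),
        ∀ p, ∀ x ∈ (BettiUniverse.hodge exists_isReal_hodgeModel_holds hP 1).piece p (((1 : ℕ) : ℤ) - p),
          Θ x = ((2 * p - ((1 : ℕ) : ℤ) : ℤ) : ℂ) • x) →
      (BettiUniverse.hodge exists_isReal_hodgeModel_holds hP 1).hodgeLie ≤ 𝔞 := by
  -- complex multiplications on the curves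
  have hcm := fun j => exists_hom_comp_self_eq_neg_of_cmCurve (hE1 j) (hEcm j)
  choose χ dE hdE hχ using hcm
  have hE2 : ∀ j, Module.finrank ℚ (E j).endAlgebra = 2 := fun j => finrank_endAlgebra_eq_two_of_cmCurve (hE1 j) (hEcm j)
  -- distinct fields: `d_i ≠ s² d_j`
  have hfree : ∀ i j, i ≠ j → ∀ s : ℚ, (dE i : ℚ) ≠ s ^ 2 * dE j := by
    intro i j hij
    have hfor : IsEmpty ((E j).endAlgebra →+* (E i).endAlgebra) := by
      by_contra hne
      rw [not_isEmpty_iff] at hne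
      exact hniso i j hij (isIsogenous_of_nonempty_ringHom_of_cmCurves (hE1 i) (hEcm i) (hE1 j) (hEcm j) hne)
    exact forall_ne_sq_mul_of_isEmpty_ringHom hfor (hE2 j) (hdE j) (hχ j) (hχ i) (hdE i)
  have hbal' : eigenMultiplicity A φ (Complex.I * (Real.sqrt d : ℂ)) = eigenMultiplicity A φ (-(Complex.I * (Real.sqrt d : ℂ))) ∨
      ∀ j, ∀ s : ℚ, (d : ℚ) ≠ s ^ 2 * dE j := by
    rcases hbal with h | h
    · exact Or.inl h
    · exact Or.inr fun j => forall_ne_sq_mul_of_isEmpty_ringHom (h j) (hE2 j) (hdE j) (hχ j) hφ hd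
  exact hodgeLie_rigid_prod_biproduct_cmCurves_of_rigid_of_quadraticEnd hA hP hA0 hA2 φ hd hφ hrigA hE1 χ dE hdE hχ hfree hbal'

/-- **`H¹(T × ⨁_j E_j)` is `Θ`-rigid for a SIMPLE abelian THREEFOLD `T` with `dim_ℚ End⁰T = 2`** (type IV(2,1), `Θ`-rigid by
`hodgeLie_rigid_of_isSimple_threefold_of_finrank_endAlgebra_eq_two`) and pairwise non-isogenous CM elliptic curves `E_j` with `End⁰E_j ↛ End⁰T`.
[cite: MoonenZarhin1999LowDim, §2 (2.3), §3 (3.1) and (3.8)] [cite: Ribet1983, Thm. 3] -/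
theorem hodgeLie_rigid_isSimple_threefold_prod_biproduct_cmCurves {T : AbelianVariety ℂ} (hP : IsSmoothProjective l (T.prod (⨁ E)).X)
    (hTs : T.IsSimple) (hT3 : T.dim = 3) (hTE : Module.finrank ℚ T.endAlgebra = 2)
    (hE1 : ∀ j, (E j).dim = 1) (hEcm : ∀ j, IsOfCMType (E j)) (hniso : ∀ i j, i ≠ j → ¬ IsIsogenous (E i) (E j))
    (hfor : ∀ j, IsEmpty ((E j).endAlgebra →+* T.endAlgebra)) :
    haveI := BettiUniverse.finite hP 1
    ∀ 𝔞 : Submodule ℚ (Module.End ℚ (bettiCohomology (T.prod (⨁ E)).X 1)),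
      𝔞 ≤ (BettiUniverse.hodge exists_isReal_hodgeModel_holds hP 1).hodgeLie →
      (∀ B ∈ 𝔞, ∀ B' ∈ 𝔞, B * B' - B' * B ∈ 𝔞) →
      (∃ Θ ∈ Submodule.span ℂ ((fun B : Module.End ℚ (bettiCohomology (T.prod (⨁ E)).X 1) => B.baseChange ℂ) ''
          (𝔞 : Set (Module.End ℚ (bettiCohomology (T.prod (⨁ E)).X 1)))),
        ∀ p, ∀ x ∈ (BettiUniverse.hodge exists_isReal_hodgeModel_holds hP 1).piece p (((1 : ℕ) : ℤ) - p),
          Θ x = ((2 * p - ((1 : ℕ) : ℤ) : ℤ) : ℂ) • x) →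
      (BettiUniverse.hodge exists_isReal_hodgeModel_holds hP 1).hodgeLie ≤ 𝔞 := by
  have hT : IsSmoothProjective T.dim T.X := AbelianVariety.isSmoothProjective_holds
  obtain ⟨φ, d, hd, hφ⟩ := exists_hom_comp_self_eq_neg_of_isSimple_threefold_of_finrank_eq_two hTs hT3 hTE
  exact hodgeLie_rigid_prod_biproduct_cmCurves_of_rigid hT hP (by omega) hTE φ hd hφ
    (hodgeLie_rigid_of_isSimple_threefold_of_finrank_endAlgebra_eq_two hT hTs hT3 hTE) hE1 hEcm hniso (Or.inr hfor)

/-- **`H¹(A × ⨁_j E_j)` is `Θ`-rigid for `A` of Ribet type `(g − 1, 1)`** (`dim A ≥ 3`, `dim_ℚ End⁰A = 2`, `φ ∘ φ = −d` with multiplicity one at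
`i√d` or at `−i√d`; `Θ`-rigid by `hodgeLie_rigid_of_ribetTypeOne`) and pairwise non-isogenous CM elliptic curves `E_j` with `End⁰E_j ↛ End⁰A`.
[cite: MoonenZarhin1999LowDim, §3 (3.1) and (3.8)] [cite: Ribet1983, Thm. 3] -/
theorem hodgeLie_rigid_ribetTypeOne_prod_biproduct_cmCurves (hP : IsSmoothProjective l (A.prod (⨁ E)).X)
    (φ : A ⟶ A) {d : ℕ} (hd : 0 < d) (hφ : φ ≫ φ = -(d • 𝟙 A)) (hA2 : Module.finrank ℚ A.endAlgebra = 2)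
    (h1 : eigenMultiplicity A φ (Complex.I * (Real.sqrt d : ℂ)) = 1 ∨ eigenMultiplicity A φ (-(Complex.I * (Real.sqrt d : ℂ))) = 1)
    (hdim : 3 ≤ A.dim) (hE1 : ∀ j, (E j).dim = 1) (hEcm : ∀ j, IsOfCMType (E j)) (hniso : ∀ i j, i ≠ j → ¬ IsIsogenous (E i) (E j))
    (hfor : ∀ j, IsEmpty ((E j).endAlgebra →+* A.endAlgebra)) :
    haveI := BettiUniverse.finite hP 1
    ∀ 𝔞 : Submodule ℚ (Module.End ℚ (bettiCohomology (A.prod (⨁ E)).X 1)),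
      𝔞 ≤ (BettiUniverse.hodge exists_isReal_hodgeModel_holds hP 1).hodgeLie →
      (∀ B ∈ 𝔞, ∀ B' ∈ 𝔞, B * B' - B' * B ∈ 𝔞) →
      (∃ Θ ∈ Submodule.span ℂ ((fun B : Module.End ℚ (bettiCohomology (A.prod (⨁ E)).X 1) => B.baseChange ℂ) ''
          (𝔞 : Set (Module.End ℚ (bettiCohomology (A.prod (⨁ E)).X 1)))),
        ∀ p, ∀ x ∈ (BettiUniverse.hodge exists_isReal_hodgeModel_holds hP 1).piece p (((1 : ℕ) : ℤ) - p),
          Θ x = ((2 * p - ((1 : ℕ) : ℤ) : ℤ) : ℂ) • x) →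
      (BettiUniverse.hodge exists_isReal_hodgeModel_holds hP 1).hodgeLie ≤ 𝔞 := by
  have hA : IsSmoothProjective A.dim A.X := AbelianVariety.isSmoothProjective_holds
  exact hodgeLie_rigid_prod_biproduct_cmCurves_of_rigid hA hP (by omega) hA2 φ hd hφ
    (hodgeLie_rigid_of_ribetTypeOne hA φ hd hφ hA2 h1 hdim) hE1 hEcm hniso (Or.inr hfor)

/-! ## §3 Monotonicity: `t((A × ⨁E) × Y) ≥ t(A × ⨁E) = t(A) + m + 1` -/

/-- **`t(A) + m + 1 ≤ t(X)` for every `X ∼ (A × ⨁_j E_j) × Y`**: `A` with `0 < dim A`, `dim_ℚ End⁰A = 2`, `φ ∘ φ = −d`, `Θ`-rigid `H¹A`;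
`E₀, …, E_m` pairwise non-isogenous CM elliptic curves with (`A` balanced OR `End⁰E_j ↛ End⁰A` for all `j`); `Y` ARBITRARY.
(`t(A × ⨁E) = t(A) + m + 1` by the tower theorem of `CorCM/MumfordTateRankTypeIVTimesCMCurvesTower`; `H¹(A × ⨁E)` is `Θ`-rigid by §2, so the
rigid-factor monotonicity of `CorCM/MumfordTateRankRigidMonotone` applies.) [cite: MoonenZarhin1999LowDim, §3 (3.1) and (3.8)] -/
theorem mtRank_hodge_one_add_le_of_isIsogenous_prod_biproduct_cmCurves_prod_of_rigid (hX : IsSmoothProjective n X.X)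
    (hA : IsSmoothProjective n₁ A.X) (hA0 : 0 < A.dim) (hA2 : Module.finrank ℚ A.endAlgebra = 2)
    (φ : A ⟶ A) {d : ℕ} (hd : 0 < d) (hφ : φ ≫ φ = -(d • 𝟙 A))
    (hrigA : haveI := BettiUniverse.finite hA 1
      ∀ 𝔞 : Submodule ℚ (Module.End ℚ (bettiCohomology A.X 1)),
        𝔞 ≤ (BettiUniverse.hodge exists_isReal_hodgeModel_holds hA 1).hodgeLie →
        (∀ B ∈ 𝔞, ∀ B' ∈ 𝔞, B * B' - B' * B ∈ 𝔞) →
        (∃ Θ ∈ Submodule.span ℂ ((fun B : Module.End ℚ (bettiCohomology A.X 1) => B.baseChange ℂ) ''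
            (𝔞 : Set (Module.End ℚ (bettiCohomology A.X 1)))),
          ∀ p, ∀ x ∈ (BettiUniverse.hodge exists_isReal_hodgeModel_holds hA 1).piece p (((1 : ℕ) : ℤ) - p),
            Θ x = ((2 * p - ((1 : ℕ) : ℤ) : ℤ) : ℂ) • x) →
        (BettiUniverse.hodge exists_isReal_hodgeModel_holds hA 1).hodgeLie ≤ 𝔞)
    (hE1 : ∀ j, (E j).dim = 1) (hEcm : ∀ j, IsOfCMType (E j)) (hniso : ∀ i j, i ≠ j → ¬ IsIsogenous (E i) (E j))
    (hbal : eigenMultiplicity A φ (Complex.I * (Real.sqrt d : ℂ)) = eigenMultiplicity A φ (-(Complex.I * (Real.sqrt d : ℂ))) ∨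
      ∀ j, IsEmpty ((E j).endAlgebra →+* A.endAlgebra))
    {Y : AbelianVariety ℂ} (hXP : IsIsogenous X ((A.prod (⨁ E)).prod Y)) :
    haveI := BettiUniverse.finite hX 1
    haveI := BettiUniverse.finite hA 1
    (BettiUniverse.hodge exists_isReal_hodgeModel_holds hA 1).mtRank + (m + 1) ≤
      (BettiUniverse.hodge exists_isReal_hodgeModel_holds hX 1).mtRank := by
  have hnA : A.dim = n₁ := schemeDim_eq_holds hA
  subst hnA
  haveI := BettiUniverse.finite hX 1
  haveI := BettiUniverse.finite hA 1
  have hP : IsSmoothProjective (A.prod (⨁ E)).dim (A.prod (⨁ E)).X := AbelianVariety.isSmoothProjective_holds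
  haveI := BettiUniverse.finite hP 1
  have hrig := hodgeLie_rigid_prod_biproduct_cmCurves_of_rigid hA hP hA0 hA2 φ hd hφ hrigA hE1 hEcm hniso hbal
  have hle := mtRank_hodge_one_le_of_isIsogenous_prod_of_rigid (X₂ := Y) hX hP (by rw [dim_prod]; omega) hrig hXP
  have hAE := mtRank_hodge_one_eq_add_of_isIsogenous_prod_biproduct_cmCurves hP hA hA0 hA2 φ hd hφ hE1 hEcm hniso hbal
    (IsIsogenous.refl _)
  omega

/-- **`m + 11 ≤ t(X)` for every `X ∼ (T × ⨁_j E_j) × Y`**, `T` a simple abelian threefold with `dim_ℚ End⁰T = 2`, `E₀, …, E_m` pairwise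
non-isogenous CM elliptic curves with `End⁰E_j ↛ End⁰T`, `Y` arbitrary (`t(T × ⨁E) = m + 11`, `H¹(T × ⨁E)` is `Θ`-rigid).
[cite: MoonenZarhin1999LowDim, §2 (2.3), §3 (3.1) and (3.8)] -/
theorem mtRank_hodge_one_le_of_isIsogenous_threefold_prod_biproduct_cmCurves_prod (hX : IsSmoothProjective n X.X) {T : AbelianVariety ℂ}
    (hTs : T.IsSimple) (hT3 : T.dim = 3) (hTE : Module.finrank ℚ T.endAlgebra = 2)
    (hE1 : ∀ j, (E j).dim = 1) (hEcm : ∀ j, IsOfCMType (E j)) (hniso : ∀ i j, i ≠ j → ¬ IsIsogenous (E i) (E j))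
    (hfor : ∀ j, IsEmpty ((E j).endAlgebra →+* T.endAlgebra)) {Y : AbelianVariety ℂ} (hXP : IsIsogenous X ((T.prod (⨁ E)).prod Y)) :
    haveI := BettiUniverse.finite hX 1
    m + 11 ≤ (BettiUniverse.hodge exists_isReal_hodgeModel_holds hX 1).mtRank := by
  have hT : IsSmoothProjective T.dim T.X := AbelianVariety.isSmoothProjective_holds
  haveI := BettiUniverse.finite hX 1
  haveI := BettiUniverse.finite hT 1
  obtain ⟨φ, d, hd, hφ⟩ := exists_hom_comp_self_eq_neg_of_isSimple_threefold_of_finrank_eq_two hTs hT3 hTE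
  have h10 : (BettiUniverse.hodge exists_isReal_hodgeModel_holds hT 1).mtRank = 10 :=
    (mtRank_hodge_one_of_isSimple_threefold_of_finrank_endAlgebra_eq_two hT hTs hT3 hTE).1
  have h := mtRank_hodge_one_add_le_of_isIsogenous_prod_biproduct_cmCurves_prod_of_rigid hX hT (by omega) hTE φ hd hφ
    (hodgeLie_rigid_of_isSimple_threefold_of_finrank_endAlgebra_eq_two hT hTs hT3 hTE) hE1 hEcm hniso (Or.inr hfor) hXP
  omega

/-- **`g² + m + 2 ≤ t(X)` for every `X ∼ (A × ⨁_j E_j) × Y`, `A` of Ribet type `(g − 1, 1)`**, `E₀, …, E_m` pairwise non-isogenous CM elliptic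
curves with `End⁰E_j ↛ End⁰A`, `Y` arbitrary (`t(A × ⨁E) = g² + m + 2`). [cite: MoonenZarhin1999LowDim, §3 (3.1) and (3.8)] [cite: Ribet1983, Thm. 3] -/
theorem mtRank_hodge_one_le_of_isIsogenous_ribetTypeOne_prod_biproduct_cmCurves_prod (hX : IsSmoothProjective n X.X)
    (hF : IsField A.endAlgebra) (hnR : ¬ NumberField.IsTotallyReal (EndField A hF)) (φ : A ⟶ A) {d : ℕ} (hd : 0 < d)
    (hφ : φ ≫ φ = -(d • 𝟙 A)) (hA2 : Module.finrank ℚ A.endAlgebra = 2)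
    (h1 : eigenMultiplicity A φ (Complex.I * (Real.sqrt d : ℂ)) = 1 ∨ eigenMultiplicity A φ (-(Complex.I * (Real.sqrt d : ℂ))) = 1)
    (hdim : 3 ≤ A.dim) (hE1 : ∀ j, (E j).dim = 1) (hEcm : ∀ j, IsOfCMType (E j)) (hniso : ∀ i j, i ≠ j → ¬ IsIsogenous (E i) (E j))
    (hfor : ∀ j, IsEmpty ((E j).endAlgebra →+* A.endAlgebra)) {Y : AbelianVariety ℂ} (hXP : IsIsogenous X ((A.prod (⨁ E)).prod Y)) :
    haveI := BettiUniverse.finite hX 1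
    A.dim * A.dim + m + 2 ≤ (BettiUniverse.hodge exists_isReal_hodgeModel_holds hX 1).mtRank := by
  have hA : IsSmoothProjective A.dim A.X := AbelianVariety.isSmoothProjective_holds
  haveI := BettiUniverse.finite hX 1
  haveI := BettiUniverse.finite hA 1
  have hgg := (mtRank_hodge_one_of_ribetTypeOne' hA hF hnR φ hd hφ hA2 h1 hdim).1
  have h := mtRank_hodge_one_add_le_of_isIsogenous_prod_biproduct_cmCurves_prod_of_rigid hX hA (by omega) hA2 φ hd hφ
    (hodgeLie_rigid_of_ribetTypeOne hA φ hd hφ hA2 h1 hdim) hE1 hEcm hniso (Or.inr hfor) hXP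
  omega

/-! ## §4 The same-field stacking cells: the curve of the field `End⁰A` is absorbed -/

/-- **`t(T × E₀ × ⋯ × E_m × E) = m + 11`** for a simple abelian threefold `T` with `dim_ℚ End⁰T = 2` (`End⁰T = k` imaginary quadratic, `t(T) = 10`),
pairwise non-isogenous CM elliptic curves `E₀, …, E_m` with `End⁰E_j ↛ k`, and a CM elliptic curve `E` with `End⁰E ↪ k`: the sandwich
`m + 11 = t(T × ⨁E) ≤ t(X)` (§3, `Y = E`) and `t(X) ≤ t(E × T) + (m + 1) = 10 + m + 1` (`X ∼ (E × T) × ⨁E`, the bound of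
`CorCM/MumfordTateRankTypeIVTimesCMCurvesTower` for ANY CM curves, and `t(E × T) = 10`, `CorCM/MumfordTateRankTimesCMCurveSameField`).
`Hg = U(2,1) × U(1)^{m+1}`: the curve of the field `k` adds nothing, each of the others adds its torus. [cite: MoonenZarhin1999LowDim, Thm. 0.1 (4), §3 (3.1) and (3.8)] -/
theorem mtRank_hodge_one_eq_of_isIsogenous_threefold_prod_biproduct_cmCurves_prod_sameField (hX : IsSmoothProjective n X.X)
    {T C : AbelianVariety ℂ} (hTs : T.IsSimple) (hT3 : T.dim = 3) (hTE : Module.finrank ℚ T.endAlgebra = 2)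
    (hE1 : ∀ j, (E j).dim = 1) (hEcm : ∀ j, IsOfCMType (E j)) (hniso : ∀ i j, i ≠ j → ¬ IsIsogenous (E i) (E j))
    (hfor : ∀ j, IsEmpty ((E j).endAlgebra →+* T.endAlgebra))
    (hC1 : C.dim = 1) (hCcm : IsOfCMType C) (hCfor : Nonempty (C.endAlgebra →+* T.endAlgebra))
    (hXP : IsIsogenous X ((T.prod (⨁ E)).prod C)) :
    haveI := BettiUniverse.finite hX 1
    (BettiUniverse.hodge exists_isReal_hodgeModel_holds hX 1).mtRank = m + 11 := by
  haveI := BettiUniverse.finite hX 1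
  have hCT : IsSmoothProjective (C.prod T).dim (C.prod T).X := AbelianVariety.isSmoothProjective_holds
  haveI := BettiUniverse.finite hCT 1
  -- lower bound: `X ∼ (T × ⨁E) × E`
  have hge := mtRank_hodge_one_le_of_isIsogenous_threefold_prod_biproduct_cmCurves_prod hX hTs hT3 hTE hE1 hEcm hniso hfor hXP
  -- upper bound: `X ∼ (E × T) × ⨁E`, `t(E × T) = 10`
  have hXQ : IsIsogenous X ((C.prod T).prod (⨁ E)) :=
    (hXP.trans (isIsogenous_prod_comm (T.prod (⨁ E)) C)).trans
      (Literature.AlgebraicGeometry.HodgeTheory.isIsogenous_prod_assoc C T (⨁ E)).symm'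
  have h10 := mtRank_hodge_one_eq_ten_of_isIsogenous_cmCurve_prod_isSimple_threefold_of_nonempty_ringHom hCT hC1 hCcm hTs hT3 hTE hCfor
    (IsIsogenous.refl _)
  have hle := mtRank_hodge_one_le_add_of_isIsogenous_prod_biproduct_cmCurves hX hCT (by rw [dim_prod]; omega) hE1 hEcm hXQ
  omega

/-- **Ribet analogue: `t(A × E₀ × ⋯ × E_m × E) = g² + m + 2`** for `A` of Ribet type `(g − 1, 1)` with `φ ∘ φ = −D`, pairwise non-isogenous CM
elliptic curves `E₀, …, E_m` with `End⁰E_j ↛ End⁰A`, and an elliptic curve `E` admitting `χ ∘ χ = −D` (the same field):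
`g² + m + 2 = t(A × ⨁E) ≤ t(X) ≤ t(E × A) + (m + 1) = (g² + 1) + m + 1` (`CorCM/MumfordTateRankRibetTimesCMCurveSameField`).
[cite: MoonenZarhin1999LowDim, Thm. 0.1 (4), §3 (3.1) and (3.8)] [cite: Ribet1983, Thm. 3] -/
theorem mtRank_hodge_one_eq_of_isIsogenous_ribetTypeOne_prod_biproduct_cmCurves_prod_sameField (hX : IsSmoothProjective n X.X)
    {C : AbelianVariety ℂ} (hF : IsField A.endAlgebra) (hnR : ¬ NumberField.IsTotallyReal (EndField A hF)) (φ : A ⟶ A) {D : ℕ}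
    (hD : 0 < D) (hφ : φ ≫ φ = -(D • 𝟙 A)) (hA2 : Module.finrank ℚ A.endAlgebra = 2)
    (h1 : eigenMultiplicity A φ (Complex.I * (Real.sqrt D : ℂ)) = 1 ∨ eigenMultiplicity A φ (-(Complex.I * (Real.sqrt D : ℂ))) = 1)
    (hdim : 3 ≤ A.dim) (hE1 : ∀ j, (E j).dim = 1) (hEcm : ∀ j, IsOfCMType (E j)) (hniso : ∀ i j, i ≠ j → ¬ IsIsogenous (E i) (E j))
    (hfor : ∀ j, IsEmpty ((E j).endAlgebra →+* A.endAlgebra))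
    (hC1 : C.dim = 1) (hCχ : ∃ χ : C ⟶ C, χ ≫ χ = -(D • 𝟙 C)) (hXP : IsIsogenous X ((A.prod (⨁ E)).prod C)) :
    haveI := BettiUniverse.finite hX 1
    (BettiUniverse.hodge exists_isReal_hodgeModel_holds hX 1).mtRank = A.dim * A.dim + m + 2 := by
  haveI := BettiUniverse.finite hX 1
  have hCA : IsSmoothProjective (C.prod A).dim (C.prod A).X := AbelianVariety.isSmoothProjective_holds
  haveI := BettiUniverse.finite hCA 1
  have hge := mtRank_hodge_one_le_of_isIsogenous_ribetTypeOne_prod_biproduct_cmCurves_prod hX hF hnR φ hD hφ hA2 h1 hdim hE1 hEcm hniso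
    hfor hXP
  have hXQ : IsIsogenous X ((C.prod A).prod (⨁ E)) :=
    (hXP.trans (isIsogenous_prod_comm (A.prod (⨁ E)) C)).trans
      (Literature.AlgebraicGeometry.HodgeTheory.isIsogenous_prod_assoc C A (⨁ E)).symm'
  have hgg := mtRank_hodge_one_eq_of_isIsogenous_ribetTypeOne_prod_cmCurve_of_exists_comp_self_eq_neg hCA hF hnR φ hD hφ hA2 h1 hdim hC1
    hCχ (IsIsogenous.refl _)
  have hle := mtRank_hodge_one_le_add_of_isIsogenous_prod_biproduct_cmCurves hX hCA (by rw [dim_prod]; omega) hE1 hEcm hXQ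
  omega

end Summit.HodgeConjecture.CorCM

end
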